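import Summits.BirchSwinnertonDyer.Rank1Residual.X11b.IntSeriesValueRigidityOneSided
import HarnessLib

/-!
# One-sided ♭-rigidity in NORM form (every prime `p`): a Λ-adic frame `Q' ∈ 𝓞_{ℂ_p}⟦T⟧` against a family of
# values whose NORMS converge — the kernel core of «H2@3 ⟸ norm continuity at 𝟙 (VN₃)» for crux
# `HalvesAtThree` (item stmt-BirchSwinnertonDyer-19107) of route `ClassRecordThree`

Cell `bsd-stepL` (run/shared/lean/pub/bsd-stepL/), seat `bsd-stepL-thmc-p1` (prover g3, D-0074 hands, 2026-08-26),
`--supports stmt-BirchSwinnertonDyer-19107` (helper). Companion of `Theorems/ClassRecordThreeHalvesAtThreeNormContinuity.lean`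
(which applies this file at `p = 3` to `Three.BDPValueAt₃`). NORM twin of the VALUE rigidity file
`X11b/IntSeriesValueRigidityOneSided.lean` (multr1-p2 gen 25 ∕ x11b3-p3 S27), whose proof it follows line by line with `‖·‖`
in place of the values.

## What this file proves (theorems only; elementary `p`-adic analysis; no definition, no named fact)

1. `intSeries_norm_constantCoeff_eq_of_tendsto_norm_of_values_mul_sq`: if `Q' ∈ 𝓞_{ℂ_p}⟦T⟧` takes the values
   `a_k·v_k` at `T_k → 0` and `a_k²·w_k` at `T_k(T_k+2)`, with `a_k ≠ 0` and ONLY THE NORMS `‖v_k‖, ‖w_k‖ → N ≠ 0`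
   converging (in `ℝ`), then `‖[T⁰]Q'‖ = N`. (`‖a_k‖ → σ = ‖[T⁰]Q'‖/N` and `‖a_k‖² → σ`, so `σ ∈ {0,1}`; `σ = 0`
   contradicts the order lemma `intSeries_norm_value_eq_of_order`, which gives `‖a_k‖·‖w_k‖ = ‖2‖^d·‖v_k‖` for
   large `k` — left side → 0, right side → `‖2‖^d·N ≠ 0`.)
2. `intSeries_norm_constantCoeff_eq_of_isBDPLFunctionInt_of_continuousNorms` (odd `p`, `K` imaginary quadratic, `κ`
   anticyclotomic with generator `γ`): if for SOME non-zero virtual periods `(Ω_K, Ω_p)` the NORMS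
   `‖ι⁻¹(bdpInterpolationValue p f 𝔭 φ_k n_k Ω_K)·Ω_p^{4n_k}‖` tend to `N₀ ≠ 0` along every interpolation sequence with
   `r_k(γ) → 1`, then every ♭-frame `Q'` of the same `(ι, 𝔭, κ, γ, f)` has `‖[T⁰]Q'‖ = N₀` (supply = the THEOREM
   `exists_interpolationSupply_pow`; transport = `intSeries_hasValueAt_frame_rescale`).

HONEST FRAMING: pure `p`-adic analysis lemmas; nothing about BSD is asserted; no node, label or census count moves (T7).

References: [Castella2018] Camb. J. Math. 6 (2018) = arXiv:1704.06608, Thm. 3.1–3.2 (pp. 8–9); [CastellaHsieh2018]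
Math. Ann. 370, §3.3; [Cassels1986] Ch. 4 Lemma 2.1; [Washington1997] §7.1.
-/

noncomputable section

open scoped Classical Topology

open Filter NumberField IsDedekindDomain Field PowerSeries
  Literature.NumberTheory.EllipticCurves Literature.NumberTheory.EllipticCurves.ModularForms
  Literature.NumberTheory.GaloisRepresentations
  Summit.BirchSwinnertonDyer.Rank1Residual Summit.BirchSwinnertonDyer.Rank1Residual.X11b
  Summit.BirchSwinnertonDyer.Rank1Residual.X11b.Halves

namespace Summit.BirchSwinnertonDyer.BirchSwinnertonDyer.Theorems

/-! ## §1 One-sided NORM rigidity (every prime `p`) -/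

section Core

variable {p : ℕ} [Fact p.Prime]

/-- **One-sided ♭-rigidity, NORM form.** Along `T_k → 0` let `Q' ∈ 𝓞_{ℂ_p}⟦T⟧` take the values `a_k·v_k` at
`T_k` and `a_k²·w_k` at `T_k(T_k + 2)`, with `a_k ≠ 0` and only the NORMS converging: `‖v_k‖, ‖w_k‖ → N ≠ 0` in
`ℝ`. Then `‖[T⁰]Q'‖ = N`: `‖a_k‖ → σ = ‖[T⁰]Q'‖/N` and `‖a_k‖² → σ`, so `σ ∈ {0,1}`; `σ = 0` contradicts the ORDER
LEMMA (`‖a_k‖·‖w_k‖ = ‖2‖^d·‖v_k‖` for large `k`); so `‖[T⁰]Q'‖ = N`. The value form is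
`intSeries_constantCoeff_eq_of_tendsto_of_values_mul_sq` (x11b3-p3 ∕ multr1-p2). [cite: Cassels1986, Ch. 4 Lemma 2.1 (order lemma; the rest is folklore p-adic analysis)] -/
theorem intSeries_norm_constantCoeff_eq_of_tendsto_norm_of_values_mul_sq {Q' : PowerSeries 𝓞_ℂ_[p]}
    {T v w a : ℕ → ℂ_[p]} {N : ℝ} (hT0 : Tendsto T atTop (𝓝 0)) (ha : ∀ k, a k ≠ 0)
    (hv_lim : Tendsto (fun k ↦ ‖v k‖) atTop (𝓝 N)) (hw_lim : Tendsto (fun k ↦ ‖w k‖) atTop (𝓝 N))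
    (hN0 : N ≠ 0) (hv' : ∀ k, IntSeries.HasValueAt Q' (T k) (a k * v k))
    (hw' : ∀ k, IntSeries.HasValueAt Q' (T k * (T k + 2)) (a k ^ 2 * w k)) :
    ‖((constantCoeff Q' : 𝓞_ℂ_[p]) : ℂ_[p])‖ = N := by
  set c' : ℂ_[p] := ((constantCoeff Q' : 𝓞_ℂ_[p]) : ℂ_[p]) with hc'def
  have hT2 : Tendsto (fun k ↦ T k + 2) atTop (𝓝 2) := by simpa using hT0.add_const 2
  have hT'0 : Tendsto (fun k ↦ T k * (T k + 2)) atTop (𝓝 0) := by simpa using hT0.mul hT2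
  -- (i) the frame's values converge to `c'`
  have hav_lim : Tendsto (fun k ↦ a k * v k) atTop (𝓝 c') :=
    intSeries_tendsto_value_of_tendsto_zero hT0 hv'
  have haw_lim : Tendsto (fun k ↦ a k ^ 2 * w k) atTop (𝓝 c') :=
    intSeries_tendsto_value_of_tendsto_zero hT'0 hw'
  have hN_nonneg : 0 ≤ N := ge_of_tendsto' hv_lim fun k ↦ norm_nonneg _
  have hN_pos : 0 < N := lt_of_le_of_ne hN_nonneg (Ne.symm hN0)
  have hvne : ∀ᶠ k in atTop, v k ≠ 0 := by
    filter_upwards [hv_lim.eventually_const_lt hN_pos] with k hk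
    exact norm_pos_iff.mp hk
  have hwne : ∀ᶠ k in atTop, w k ≠ 0 := by
    filter_upwards [hw_lim.eventually_const_lt hN_pos] with k hk
    exact norm_pos_iff.mp hk
  -- (ii) `‖a_k‖ → σ` and `‖a_k‖² → σ`
  set σ : ℝ := ‖c'‖ / N with hσdef
  have ha_lim : Tendsto (fun k ↦ ‖a k‖) atTop (𝓝 σ) := by
    refine (hav_lim.norm.div hv_lim hN0).congr' ?_
    filter_upwards [hvne] with k hk
    simp only [Pi.div_apply]
    rw [norm_mul]
    exact mul_div_cancel_right₀ ‖a k‖ (norm_ne_zero_iff.mpr hk)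
  have ha2_lim : Tendsto (fun k ↦ ‖a k‖ ^ 2) atTop (𝓝 σ) := by
    refine (haw_lim.norm.div hw_lim hN0).congr' ?_
    filter_upwards [hwne] with k hk
    simp only [Pi.div_apply]
    rw [norm_mul, norm_pow]
    exact mul_div_cancel_right₀ (‖a k‖ ^ 2) (norm_ne_zero_iff.mpr hk)
  have hσsq : σ ^ 2 = σ := tendsto_nhds_unique (ha_lim.pow 2) ha2_lim
  have hσ01 : σ = 0 ∨ σ = 1 := by
    have h : σ * (σ - 1) = 0 := by rw [mul_sub, mul_one, ← sq, hσsq, sub_self]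
    rcases mul_eq_zero.mp h with h | h
    · exact Or.inl h
    · exact Or.inr (sub_eq_zero.mp h)
  rcases hσ01 with hσ0 | hσ1
  · -- (ii') `σ = 0` is impossible
    exfalso
    have han : Tendsto (fun k ↦ ‖a k‖) atTop (𝓝 0) := hσ0 ▸ ha_lim
    obtain ⟨K₀, hK₀⟩ := hvne.exists
    have hQ'ne : Q' ≠ 0 := by
      intro h0
      have h00 := intSeries_hasValueAt_zero_series (p := p) (T K₀)
      rw [← h0] at h00
      exact mul_ne_zero (ha K₀) hK₀ ((hv' K₀).unique h00)
    set d : ℕ := Q'.order.toNat with hddef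
    set g₀ : ℂ_[p] := ((coeff d Q' : 𝓞_ℂ_[p]) : ℂ_[p]) with hg₀def
    have hg₀ : g₀ ≠ 0 := by
      rw [hg₀def, Ne, ZeroMemClass.coe_eq_zero, hddef]
      exact coeff_order hQ'ne
    have hg₀pos : 0 < ‖g₀‖ := norm_pos_iff.mpr hg₀
    have h2pos : 0 < ‖(2 : ℂ_[p])‖ := norm_pos_iff.mpr two_ne_zero
    have hTn : Tendsto (fun k ↦ ‖T k‖) atTop (𝓝 0) := tendsto_zero_iff_norm_tendsto_zero.mp hT0
    have hT'n : Tendsto (fun k ↦ ‖T k * (T k + 2)‖) atTop (𝓝 0) :=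
      tendsto_zero_iff_norm_tendsto_zero.mp hT'0
    have E1 : ∀ᶠ k in atTop, ‖T k‖ < 1 := hTn.eventually_lt_const zero_lt_one
    have E2 : ∀ᶠ k in atTop, ‖T k‖ < ‖g₀‖ := hTn.eventually_lt_const hg₀pos
    have E3 : ∀ᶠ k in atTop, ‖T k * (T k + 2)‖ < 1 := hT'n.eventually_lt_const zero_lt_one
    have E4 : ∀ᶠ k in atTop, ‖T k * (T k + 2)‖ < ‖g₀‖ := hT'n.eventually_lt_const hg₀pos
    have E7 : ∀ᶠ k in atTop, ‖T k + 2‖ = ‖(2 : ℂ_[p])‖ :=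
      eventually_norm_eq_of_tendsto two_ne_zero hT2
    -- the order lemma at both families: eventually `‖a_k‖·‖w_k‖ = ‖2‖^d·‖v_k‖`
    have hEq : ∀ᶠ k in atTop, ‖a k‖ * ‖w k‖ = ‖(2 : ℂ_[p])‖ ^ d * ‖v k‖ := by
      filter_upwards [E1, E2, E3, E4, E7] with k h1 h2 h3 h4 h7
      have hA : ‖a k‖ * ‖v k‖ = ‖T k‖ ^ d * ‖g₀‖ := by
        rw [← norm_mul (a k) (v k)]
        exact intSeries_norm_value_eq_of_order h1 h2 (hv' k)
      have hB : ‖a k‖ ^ 2 * ‖w k‖ = ‖T k‖ ^ d * ‖(2 : ℂ_[p])‖ ^ d * ‖g₀‖ := by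
        rw [← h7, ← mul_pow, ← norm_mul (T k) (T k + 2), ← norm_pow (a k) 2,
          ← norm_mul (a k ^ 2) (w k)]
        exact intSeries_norm_value_eq_of_order h3 h4 (hw' k)
      have hB' : ‖a k‖ * (‖a k‖ * ‖w k‖) = ‖a k‖ * (‖(2 : ℂ_[p])‖ ^ d * ‖v k‖) := by
        calc ‖a k‖ * (‖a k‖ * ‖w k‖) = ‖a k‖ ^ 2 * ‖w k‖ := by ring
          _ = ‖T k‖ ^ d * ‖(2 : ℂ_[p])‖ ^ d * ‖g₀‖ := hB
          _ = ‖(2 : ℂ_[p])‖ ^ d * (‖T k‖ ^ d * ‖g₀‖) := by ring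
          _ = ‖(2 : ℂ_[p])‖ ^ d * (‖a k‖ * ‖v k‖) := by rw [hA]
          _ = ‖a k‖ * (‖(2 : ℂ_[p])‖ ^ d * ‖v k‖) := by ring
      exact mul_left_cancel₀ (norm_ne_zero_iff.mpr (ha k)) hB'
    have hL : Tendsto (fun k ↦ ‖a k‖ * ‖w k‖) atTop (𝓝 (0 * N)) := han.mul hw_lim
    have hR : Tendsto (fun k ↦ ‖(2 : ℂ_[p])‖ ^ d * ‖v k‖) atTop (𝓝 (‖(2 : ℂ_[p])‖ ^ d * N)) :=
      hv_lim.const_mul _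
    have hlim_eq : (0 : ℝ) * N = ‖(2 : ℂ_[p])‖ ^ d * N := tendsto_nhds_unique (hL.congr' hEq) hR
    rw [zero_mul] at hlim_eq
    exact mul_ne_zero (pow_ne_zero _ h2pos.ne') hN0 hlim_eq.symm
  · -- (iii) `σ = 1`: `‖c'‖ = N`
    exact (div_eq_one_iff_eq hN0).mp hσ1

end Core

/-! ## §2 The BDP form: a ♭-frame against virtual periods whose display NORMS converge -/

section BDP

variable {p : ℕ} [Fact p.Prime] {K : Type} [Field K] [NumberField K] {N : ℕ}

/-- **One-sided ♭-rigidity in NORM form at the BDP frames, supply discharged.** For odd `p`, `K` imaginary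
quadratic, `κ` anticyclotomic with topological generator `γ`: if for some non-zero virtual periods `(Ω_K, Ω_p)` the
NORMS `‖ι⁻¹(bdpInterpolationValue p f 𝔭 φ_k n_k Ω_K)·Ω_p^{4n_k}‖` of the would-be interpolation values tend to
`N₀ ≠ 0` along EVERY interpolation sequence `(φ_k, n_k, r_k)` with `r_k(γ) → 1`, then every ♭-frame
`(Ω_K', Ω_p', Q')` of the same `(ι, 𝔭, κ, γ, f)` has `‖[T⁰]Q'‖ = N₀`. The two families `φ^{p^k}`, `φ^{2p^k}` of the
supply `exists_interpolationSupply_pow` carry the frame's values `β^{m p^k}·v_k`, `β^{2 m p^k}·w_k`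
(`intSeries_hasValueAt_frame_rescale`, `β` the period ratio), and §1 applies. The VALUE form is
`intSeries_constantCoeff_eq_of_isBDPLFunctionInt_of_continuousValues`.
[cite: Castella2018, Thm. 3.1–3.2 (arXiv:1704.06608 pp. 8–9) (display shape only)] -/
theorem intSeries_norm_constantCoeff_eq_of_isBDPLFunctionInt_of_continuousNorms (hp2 : p ≠ 2)
    {ι : PadicAlgCl p ≃+* ℂ} {𝔭 : HeightOneSpectrum (𝓞 K)} {κ : ZpExtension K p}
    {γ : Field.absoluteGaloisGroup K} {f : CuspForm (CongruenceSubgroup.Gamma0 N) 2}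
    {ΩK ΩK' : ℂ} {Ωp Ωp' : ℂ_[p]} {Q' : PowerSeries 𝓞_ℂ_[p]} {N₀ : ℝ}
    (hK : IsImaginaryQuadratic K) (hκ : κ.IsAnticyclotomic) (hγ : κ.IsTopGenerator γ)
    (hΩK : ΩK ≠ 0) (hΩK' : ΩK' ≠ 0) (hΩp : Ωp ≠ 0) (hΩp' : Ωp' ≠ 0)
    (hcont : ∀ (φ : ℕ → HeckeCharacter K) (n : ℕ → ℕ) (r : ℕ → FramedGaloisRep K (PadicAlgCl p) 1),
      (∀ k, 0 < n k) → (∀ k (v : HeightOneSpectrum (𝓞 K)), (φ k).IsUnramifiedAt v) →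
      (∀ k, (φ k).HasInfinityType (fun _ ↦ (n k : ℤ)) (fun _ ↦ -(n k : ℤ))) →
      (∀ k, IsPAdicAvatarOf ι (φ k) (r k)) → (∀ k, FactorsThroughZp κ (r k)) →
      Tendsto (fun k ↦ avatarValueAt (r k) γ) atTop (𝓝 1) →
      Tendsto (fun k ↦ ‖((ι.symm (bdpInterpolationValue p f 𝔭 (φ k) (n k) ΩK) : PadicAlgCl p) :
        ℂ_[p]) * Ωp ^ (4 * n k)‖) atTop (𝓝 N₀))
    (hN₀ : N₀ ≠ 0) (hQ' : R1.IsBDPLFunctionInt p ι 𝔭 κ γ f ΩK' Ωp' Q') :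
    ‖((constantCoeff Q' : 𝓞_ℂ_[p]) : ℂ_[p])‖ = N₀ := by
  have hp : p.Prime := Fact.out
  obtain ⟨m, x₀, φ, φ', r, r', hm, -, hx, hunr, hinf, hr, hrκ, hval, hunr', hinf', hr', hrκ', hval'⟩ :=
    exists_interpolationSupply_pow hp2 ι K κ hK hκ γ hγ
  have hn : ∀ k, 0 < m * p ^ k := fun k ↦ Nat.mul_pos hm (pow_pos hp.pos k)
  have hn' : ∀ k, 0 < 2 * m * p ^ k := fun k ↦ Nat.mul_pos (Nat.mul_pos two_pos hm) (pow_pos hp.pos k)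
  have hlim : Tendsto (fun k ↦ avatarValueAt (r k) γ) atTop (𝓝 1) := by
    simp_rw [hval]; exact hx
  have hlim' : Tendsto (fun k ↦ avatarValueAt (r' k) γ) atTop (𝓝 1) := by
    simp_rw [hval']
    have h2 : Tendsto (fun k ↦ (x₀ ^ p ^ k) ^ 2) atTop (𝓝 1) := by simpa using hx.pow 2
    refine h2.congr fun k ↦ ?_
    ring
  -- the NORM limits along the two families
  have hv := hcont (fun k ↦ φ k) (fun k ↦ m * p ^ k) r hn hunr hinf hr hrκ hlim
  have hw := hcont (fun k ↦ φ' k) (fun k ↦ 2 * m * p ^ k) r' hn' hunr' hinf' hr' hrκ' hlim'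
  -- the points and the period-ratio factor
  set T : ℕ → ℂ_[p] := fun k ↦ x₀ ^ p ^ k - 1 with hT
  have hT0 : Tendsto T atTop (𝓝 0) := by
    have h := hx.sub_const 1
    rwa [sub_self] at h
  set β : ℂ_[p] := ((ι.symm ((ΩK / ΩK') ^ 4) : PadicAlgCl p) : ℂ_[p]) * (Ωp' / Ωp) ^ 4 with hβ
  have hβ0 : β ≠ 0 := by
    refine mul_ne_zero ?_ (pow_ne_zero _ (div_ne_zero hΩp' hΩp))
    rw [PadicComplex.coe_eq]
    exact (map_ne_zero_iff _ (algebraMap (PadicAlgCl p) ℂ_[p]).injective).mpr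
      ((map_ne_zero_iff _ ι.symm.injective).mpr (pow_ne_zero _ (div_ne_zero hΩK hΩK')))
  set a : ℕ → ℂ_[p] := fun k ↦ β ^ (m * p ^ k) with ha
  have ha0 : ∀ k, a k ≠ 0 := fun k ↦ pow_ne_zero _ hβ0
  have hT' : ∀ k, x₀ ^ (2 * p ^ k) - 1 = T k * (T k + 2) := by
    intro k
    simp only [hT]
    ring
  set v : ℕ → ℂ_[p] := fun k ↦
    ((ι.symm (bdpInterpolationValue p f 𝔭 (φ k) (m * p ^ k) ΩK) : PadicAlgCl p) : ℂ_[p]) *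
      Ωp ^ (4 * (m * p ^ k)) with hvdef
  set w : ℕ → ℂ_[p] := fun k ↦
    ((ι.symm (bdpInterpolationValue p f 𝔭 (φ' k) (2 * m * p ^ k) ΩK) : PadicAlgCl p) : ℂ_[p]) *
      Ωp ^ (4 * (2 * m * p ^ k)) with hwdef
  have hQ'v : ∀ k, IntSeries.HasValueAt Q' (T k) (a k * v k) := by
    intro k
    have h := intSeries_hasValueAt_frame_rescale hΩK hΩK' hΩp hQ' (hn k) (hunr k) (hinf k) (hr k)
      (hrκ k)
    have hvals : ((ι.symm (bdpInterpolationValue p f 𝔭 (φ k) (m * p ^ k) ΩK) : PadicAlgCl p) :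
        ℂ_[p]) * Ωp ^ (4 * (m * p ^ k)) *
        (((ι.symm ((ΩK / ΩK') ^ 4) : PadicAlgCl p) : ℂ_[p]) * (Ωp' / Ωp) ^ 4) ^ (m * p ^ k) =
        a k * v k := by
      simp only [ha, hvdef, hβ]
      ring
    rw [hval k, hvals] at h
    exact h
  have hQ'w : ∀ k, IntSeries.HasValueAt Q' (T k * (T k + 2)) (a k ^ 2 * w k) := by
    intro k
    have h := intSeries_hasValueAt_frame_rescale hΩK hΩK' hΩp hQ' (hn' k) (hunr' k) (hinf' k)
      (hr' k) (hrκ' k)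
    have hvals : ((ι.symm (bdpInterpolationValue p f 𝔭 (φ' k) (2 * m * p ^ k) ΩK) :
        PadicAlgCl p) : ℂ_[p]) * Ωp ^ (4 * (2 * m * p ^ k)) *
        (((ι.symm ((ΩK / ΩK') ^ 4) : PadicAlgCl p) : ℂ_[p]) * (Ωp' / Ωp) ^ 4) ^ (2 * m * p ^ k) =
        a k ^ 2 * w k := by
      simp only [ha, hwdef, hβ]
      ring
    rw [hval' k, hT' k, hvals] at h
    exact h
  exact intSeries_norm_constantCoeff_eq_of_tendsto_norm_of_values_mul_sq hT0 ha0 hv hw hN₀ hQ'v hQ'w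

end BDP

end Summit.BirchSwinnertonDyer.BirchSwinnertonDyer.Theorems

end
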